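/-
COR-CM (cell pub-hodgecm2, stage 2 of the Hodge ladder) — count-neutral KERNEL COMBINATORICS «the dihedral law», part Ia: the dihedral datum
`(G ⊃ ⟨g⟩, c = gⁿ, s)` and the arcs of `ℤ/2n` (seat prover-pub-hodgecm2-b23-g48-0, binder prover b23, gen 48; claim «DIHEDRAL LAW»,
HOME/INBOX.md l.22267).  One structure (`Datum`) + theorems, on top of seat b09ʼs intrinsic model
(`CMF G c`, `rt`, `oflipCM`, `orb`: `CorCM/Prior/AllgGroup1.lean`, `Census/BlockParityLaw.lean`) and seat b09ʼs `ℤ/2n` value lemmas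
(`QuaternionColumn.val_sub_one_of_ne`, `val_neg_one`: `Census/QuaternionColumnBiarc.lean`) used BY NAME; no `decide` beyond closed
numerals, no certificate, no named fact, no `sorry`; `Interfaces.lean` (C1), every E term, B01, `Transposition/*`, `PortJoin/*`, `D2Bridge/*` untouched.
HONEST FRAMING: `HC_CM` is NOT proved, here or anywhere in the tree; nothing here is a period, a count of record or a headline.
T5: n/a-class (hypothesis binders are the fields of `Datum`: `gⁿ = c`, `orderOf g = 2n`, `[⟨g⟩ : G] = 2`, `s ∉ ⟨g⟩`, elements outside `⟨g⟩`
are involutions — inhabited by the dihedral group of order `4n`; checker: self).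
-/
import Summits.HodgeConjecture.CorCM.Census.CyclicFacesResidue
import Summits.HodgeConjecture.CorCM.Census.TwistGenerationModel
import Summits.HodgeConjecture.CorCM.Census.QuaternionColumnBiarc

/-!
# The dihedral law, Ia: the dihedral datum and the arcs of `ℤ/2n`

THE SETTING.  `G` a finite group, `g ∈ G` of order `2n` generating a subgroup of index two, `c = gⁿ` (a central involution), and every element
outside `⟨g⟩` an involution (`Datum`): `G` is the generalised dihedral group `D(ℤ/2n)` of order `4n` — the dihedral group `D_{2n}` with its central
rotation as complex conjugation (`D₈ = D(ℤ/8)`, `D₁₂ = D(ℤ/12)`, `D₁₆`, …).  Every element is a rotation `gⁱ` or a reflection `gⁱ·s`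
(`exists_pow_or_pow_mul_s`), `s·gⁱ = g⁻ⁱ·s`.

An abstract CM type `Ψ : CMF G c` is read through two CM types of the cyclic group `ℤ/2n`: its ROTATION PART `{i ∣ gⁱ ∈ Ψ}` and its REFLECTION
PART `{i ∣ gⁱ·s ∈ Ψ}` (= the rotation part of the base change `Ψ·s`, `mem_rt`).  The base change along `gᵏ` translates the two parts in OPPOSITE
directions, the base change along `s` SWAPS them.

* §1 the datum: `s·s = 1`, `s·gⁱ·s = g⁻ⁱ`, `c` central, `c·c = 1`, `c ≠ 1`, every element is `gⁱ` or `gⁱ·s` with `i < 2n`.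
* §2 arcs of `ℤ/2n`: `z ∈ (a, a+n]` is written `(z − a − 1).val < n` throughout (no definition); `z + n` lies in the arc iff `z` does not; the end-point flip rule.
Part Ib (`Census/DihedralArcPairs.lean`) builds the ARC PAIRS `A(a, b)` on this; parts II–IV (`Census/DihedralArcPairsHodge.lean`, `Census/DihedralDescent.lean`, `Census/DihedralLaw.lean`): Hodge vectors supported on
`B_0 ∪ B_1` are sums of pairs; every type descends to arc pairs along seat b23 gen 38ʼs cyclic boundary descent run in both coordinates; hence
`β − 2` face orbits generate the Hodge lattice modulo pairs and `μ(D(ℤ/2n), gⁿ) = β − 2 = φ₂` for every `n ≥ 2`.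

## References
* [Pohlmann1968] H. Pohlmann, Algebraic cycles on abelian varieties of complex multiplication type, Ann. of Math. 88 (1968), Thm 1.
* [Milne1999] J. S. Milne, Lefschetz motives and the Tate conjecture, Compositio Math. 117 (1999), Prop. 2.1, p. 54.
-/

namespace Summit.HodgeConjecture.CorCM.Census.Dihedral

open Finset
open Summit.HodgeConjecture.CorCM.Prior.AllgGroup.RfwfAllgGroup
open Summit.HodgeConjecture.CorCM.Census.BlockParity

noncomputable section

variable {G : Type*} [Group G] [Fintype G] [DecidableEq G] {c : G} {n : ℕ} [NeZero n]

/-! ## §1 The dihedral datum -/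

/-- **A dihedral datum for `(G, c)` at level `n`**: a rotation `g` of order `2n` with `gⁿ = c` generating a subgroup of index two, and an
element `s` outside it, every element outside `⟨g⟩` being an involution.  Then `G ≅ D(ℤ/2n)` is the dihedral group of order `4n` and `c` its
central rotation. [folklore] -/
structure Datum (G : Type*) [Group G] (c : G) (n : ℕ) where
  /-- the generating rotation -/
  g : G
  /-- a reflection -/
  s : G
  /-- `gⁿ = c` -/
  hgn : g ^ n = c
  /-- `g` has order `2n` -/
  hord : orderOf g = 2 * n
  /-- the rotations form a subgroup of index two -/
  hindex : (Subgroup.zpowers g).index = 2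
  /-- `s` is not a rotation -/
  hs : s ∉ Subgroup.zpowers g
  /-- every non-rotation is an involution -/
  hinvol : ∀ x : G, x ∉ Subgroup.zpowers g → x * x = 1

variable (D : Datum G c n)

namespace Datum

include D

omit [Fintype G] [DecidableEq G] [NeZero n] in
/-- `s` is an involution. [folklore] -/
theorem s_mul_s : D.s * D.s = 1 := D.hinvol D.s D.hs

omit [Fintype G] [DecidableEq G] [NeZero n] in
/-- `s⁻¹ = s`. [folklore] -/
theorem s_inv : D.s⁻¹ = D.s := inv_eq_of_mul_eq_one_right D.s_mul_s

omit [Fintype G] [DecidableEq G] [NeZero n] in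
/-- A rotation times `s` is not a rotation. [folklore] -/
theorem mul_s_notMem {x : G} (hx : x ∈ Subgroup.zpowers D.g) : x * D.s ∉ Subgroup.zpowers D.g := fun h =>
  D.hs (by simpa only [inv_mul_cancel_left] using Subgroup.mul_mem _ (Subgroup.inv_mem _ hx) h)

omit [Fintype G] [DecidableEq G] [NeZero n] in
/-- `gⁱ·s` is not a rotation. [folklore] -/
theorem pow_mul_s_notMem (i : ℕ) : D.g ^ i * D.s ∉ Subgroup.zpowers D.g :=
  D.mul_s_notMem (Subgroup.pow_mem _ (Subgroup.mem_zpowers _) i)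

omit [Fintype G] [DecidableEq G] [NeZero n] in
/-- **The dihedral relation** `s·x·s = x⁻¹` for every rotation `x`. [folklore] -/
theorem s_mul_mul_s {x : G} (hx : x ∈ Subgroup.zpowers D.g) : D.s * x * D.s = x⁻¹ := by
  have h := D.hinvol (x * D.s) (D.mul_s_notMem hx)
  -- `x s x s = 1` ⟹ `s x s = x⁻¹`
  have e : D.s * x * D.s = x⁻¹ * (x * D.s * (x * D.s)) := by group
  rw [e, h, mul_one]

omit [Fintype G] [DecidableEq G] [NeZero n] in
/-- `s·gⁱ·s = (gⁱ)⁻¹`. [folklore] -/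
theorem s_mul_pow_mul_s (i : ℕ) : D.s * D.g ^ i * D.s = (D.g ^ i)⁻¹ :=
  D.s_mul_mul_s (Subgroup.pow_mem _ (Subgroup.mem_zpowers _) i)

omit [Fintype G] [DecidableEq G] [NeZero n] in
/-- `s·gⁱ = (gⁱ)⁻¹·s`. [folklore] -/
theorem s_mul_pow (i : ℕ) : D.s * D.g ^ i = (D.g ^ i)⁻¹ * D.s := by
  have h := D.s_mul_pow_mul_s i
  calc D.s * D.g ^ i = D.s * D.g ^ i * D.s * D.s := by rw [mul_assoc (D.s * D.g ^ i), D.s_mul_s, mul_one]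
    _ = (D.g ^ i)⁻¹ * D.s := by rw [h]

omit [DecidableEq G] [NeZero n] in
/-- `g` has positive order, so `n ≥ 1`. [folklore] -/
theorem one_le : 1 ≤ n := by
  have h := D.hord
  have hpos : 0 < orderOf D.g := orderOf_pos D.g
  omega

omit [Fintype G] [DecidableEq G] [NeZero n] in
/-- `g^{2n} = 1`. [folklore] -/
theorem pow_two_mul : D.g ^ (2 * n) = 1 := by rw [← D.hord]; exact pow_orderOf_eq_one D.g

omit [Fintype G] [DecidableEq G] [NeZero n] in
/-- `c·c = 1`. [folklore] -/
theorem c_mul_c : c * c = 1 := by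
  have h : D.g ^ n * D.g ^ n = 1 := by rw [← pow_add, ← two_mul]; exact D.pow_two_mul
  rwa [D.hgn] at h

omit [DecidableEq G] [NeZero n] in
/-- `c ≠ 1` (`g` has order `2n > n`). [folklore] -/
theorem c_ne_one : c ≠ 1 := by
  intro h
  have h1 : D.g ^ n = 1 := by rw [D.hgn, h]
  have hdvd := orderOf_dvd_of_pow_eq_one h1
  rw [D.hord] at hdvd
  have := Nat.le_of_dvd (by have := D.one_le; omega) hdvd
  have := D.one_le
  omega

omit [DecidableEq G] [NeZero n] in
/-- The inverse of a power of `g` as a power: `(gᵏ)⁻¹ = g^{k(2n−1)}`. [folklore] -/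
theorem inv_pow_eq (k : ℕ) : (D.g ^ k)⁻¹ = D.g ^ (k * (2 * n - 1)) := by
  apply inv_eq_of_mul_eq_one_right
  rw [← pow_add]
  have e : k + k * (2 * n - 1) = (2 * n) * k := by
    have := D.one_le
    zify [show 1 ≤ 2 * n by omega]
    ring
  rw [e, pow_mul, D.pow_two_mul, one_pow]

omit [DecidableEq G] [NeZero n] in
/-- In `ℤ/2n`, the exponent `k(2n−1)` is `−k`. [folklore] -/
theorem natCast_mul_pred (k : ℕ) : ((k * (2 * n - 1) : ℕ) : ZMod (2 * n)) = -(k : ZMod (2 * n)) := by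
  have h1 : 1 ≤ 2 * n := by have := D.one_le; omega
  have e : ((k * (2 * n - 1) : ℕ) : ZMod (2 * n)) + (k : ZMod (2 * n)) = 0 := by
    rw [← Nat.cast_add]
    have e2 : k * (2 * n - 1) + k = k * (2 * n) := by zify [h1]; ring
    rw [e2, Nat.cast_mul, ZMod.natCast_self, mul_zero]
  exact eq_neg_of_add_eq_zero_left e

omit [DecidableEq G] [NeZero n] in
/-- **Every element is a rotation `gⁱ` or a reflection `gⁱ·s`**, `i < 2n`. [folklore] -/
theorem exists_pow_or_pow_mul_s (x : G) : ∃ i : ℕ, i < 2 * n ∧ (x = D.g ^ i ∨ x = D.g ^ i * D.s) := by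
  have hfin : ∀ y : G, y ∈ Subgroup.zpowers D.g → ∃ i : ℕ, i < 2 * n ∧ D.g ^ i = y := by
    intro y hy
    have hy' : y ∈ Submonoid.powers D.g := ((isOfFinOrder_of_finite D.g).mem_powers_iff_mem_zpowers).mpr hy
    obtain ⟨k, rfl⟩ := Submonoid.mem_powers_iff _ _ |>.mp hy'
    refine ⟨k % (2 * n), ?_, ?_⟩
    · have := D.one_le
      exact Nat.mod_lt _ (by omega)
    · rw [← D.hord, pow_mod_orderOf]
  by_cases hx : x ∈ Subgroup.zpowers D.g
  · obtain ⟨i, hi, h⟩ := hfin x hx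
    exact ⟨i, hi, Or.inl h.symm⟩
  · have hxs : x * D.s ∈ Subgroup.zpowers D.g := by
      rw [Subgroup.mul_mem_iff_of_index_two D.hindex]
      exact ⟨fun h => absurd h hx, fun h => absurd h D.hs⟩
    obtain ⟨i, hi, h⟩ := hfin (x * D.s) hxs
    refine ⟨i, hi, Or.inr ?_⟩
    calc x = x * D.s * D.s := by rw [mul_assoc, D.s_mul_s, mul_one]
      _ = D.g ^ i * D.s := by rw [h]

omit [DecidableEq G] [NeZero n] in
/-- `c` is central. [folklore] -/
theorem hcen : ∀ x : G, x * c = c * x := by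
  have hgc : ∀ i : ℕ, D.g ^ i * c = c * D.g ^ i := fun i => by
    have h : D.g ^ i * D.g ^ n = D.g ^ n * D.g ^ i := by rw [← pow_add, ← pow_add, add_comm]
    rwa [D.hgn] at h
  have hsc : D.s * c = c * D.s := by
    have h : D.s * D.g ^ n = (D.g ^ n)⁻¹ * D.s := D.s_mul_pow n
    have hcinv : c⁻¹ = c := inv_eq_of_mul_eq_one_right D.c_mul_c
    rw [D.hgn, hcinv] at h
    exact h
  intro x
  obtain ⟨i, -, h | h⟩ := D.exists_pow_or_pow_mul_s x
  · rw [h, hgc]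
  · rw [h, mul_assoc, hsc, ← mul_assoc, hgc, mul_assoc]

omit [Fintype G] [DecidableEq G] [NeZero n] in
/-- Powers of `g` are determined modulo `2n`: `gⁱ = gʲ ↔ i ≡ j (mod 2n)`. [folklore] -/
theorem pow_eq_pow_iff (i j : ℕ) : D.g ^ i = D.g ^ j ↔ (i : ZMod (2 * n)) = (j : ZMod (2 * n)) := by
  rw [pow_eq_pow_iff_modEq, D.hord, ZMod.natCast_eq_natCast_iff]

omit [Fintype G] [DecidableEq G] [NeZero n] in
/-- A rotation is not a reflection. [folklore] -/
theorem pow_ne_pow_mul_s (i j : ℕ) : D.g ^ i ≠ D.g ^ j * D.s := fun h =>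
  D.pow_mul_s_notMem j (h ▸ Subgroup.pow_mem _ (Subgroup.mem_zpowers _) i)

omit [Fintype G] [DecidableEq G] [NeZero n] in
/-- Reflections are determined by their exponent modulo `2n`. [folklore] -/
theorem pow_mul_s_eq_iff (i j : ℕ) : D.g ^ i * D.s = D.g ^ j * D.s ↔ (i : ZMod (2 * n)) = (j : ZMod (2 * n)) := by
  rw [← D.pow_eq_pow_iff]
  constructor
  · intro h; exact mul_right_cancel h
  · intro h; rw [h]

end Datum


/-! ## §2 Arcs of `ℤ/2n` -/

/-- The value of `w + n` in `ℤ/2n`: add `n` below `n`, subtract `n` above. [folklore] -/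
theorem val_add_n (hn : 1 ≤ n) (w : ZMod (2 * n)) :
    (w + (n : ZMod (2 * n))).val = if w.val < n then w.val + n else w.val - n := by
  have hw := ZMod.val_lt w
  rw [ZMod.val_add, ZMod.val_natCast, Nat.mod_eq_of_lt (show n < 2 * n by omega)]
  split_ifs with h
  · exact Nat.mod_eq_of_lt (by omega)
  · rw [Nat.mod_eq_sub_mod (by omega), Nat.mod_eq_of_lt (by omega)]
    omega

/-- **`z + n` lies in the arc at `a` iff `z` does not.** [folklore] -/
theorem inArc_add_n (hn : 1 ≤ n) (a z : ZMod (2 * n)) : ((z + n) - a - 1).val < n ↔ ¬ (z - a - 1).val < n := by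
  have e : z + (n : ZMod (2 * n)) - a - 1 = (z - a - 1) + n := by ring
  rw [e, val_add_n hn]
  have hw := ZMod.val_lt (z - a - 1)
  split_ifs with h
  · constructor
    · intro h'; omega
    · intro h'; exact absurd h h'
  · constructor
    · intro _ h'; exact h h'
    · intro _; omega

omit [NeZero n] in
/-- Shifting the arc: `z` lies in the arc at `a − k` iff `z + k` lies in the arc at `a`. [folklore] -/
theorem inArc_sub_iff (a z k : ZMod (2 * n)) : (z - (a - k) - 1).val < n ↔ ((z + k) - a - 1).val < n := by
  have e : z - (a - k) - 1 = z + k - a - 1 := by ring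
  rw [e]

omit [NeZero n] in
/-- Shifting the arc the other way: `z` lies in the arc at `a + k` iff `z − k` lies in the arc at `a`. [folklore] -/
theorem inArc_add_iff (a z k : ZMod (2 * n)) : (z - (a + k) - 1).val < n ↔ ((z - k) - a - 1).val < n := by
  have e : z - (a + k) - 1 = z - k - a - 1 := by ring
  rw [e]

/-- **The end-point flip rule** in `ℤ/2n`: `w ∈ [0, n)` iff NOT (`w − 1 ∈ [0, n)` ↔ `w ∈ {0, n}`) — moving the arc `(−1, n−1]` to `(0, n]`
toggles exactly the end points `0` and `n`. [folklore] -/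
theorem val_lt_iff_not_iff (hn : 1 ≤ n) (w : ZMod (2 * n)) :
    w.val < n ↔ ¬ ((w - 1).val < n ↔ (w = 0 ∨ w = (n : ZMod (2 * n)))) := by
  have hw := ZMod.val_lt w
  have hnval : ((n : ZMod (2 * n))).val = n := by rw [ZMod.val_natCast, Nat.mod_eq_of_lt (by omega)]
  have hwn : w = (n : ZMod (2 * n)) ↔ w.val = n := by
    constructor
    · intro h; rw [h, hnval]
    · intro h; apply ZMod.val_injective; rw [h, hnval]
  by_cases h0 : w = 0
  · subst h0
    rw [zero_sub, QuaternionColumn.val_neg_one, ZMod.val_zero]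
    have : ¬ (2 * n - 1 < n) := by omega
    tauto
  · have hv0 : w.val ≠ 0 := fun h => h0 ((ZMod.val_eq_zero w).mp h)
    rw [QuaternionColumn.val_sub_one_of_ne h0, hwn]
    constructor
    · intro hlt
      rintro ⟨h1, h2⟩
      rcases h1 (by omega) with h | h
      · exact h0 h
      · omega
    · intro h
      by_contra hge
      apply h
      constructor
      · intro h3; right; omega
      · rintro (h3 | h3)
        · exact absurd h3 h0
        · omega

omit [NeZero n] in
end

end Summit.HodgeConjecture.CorCM.Census.Dihedral
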